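import Mathlib
import Summits.ValiantsHypothesis.ValiantsHypothesis.Theses.ValuativeGCT
import Literature.Computability.AlgebraicComplexity.MultiplicityObstructionsProofs
import Literature.NumberTheory.DiophantineGeometry.SchurWeylPlethysmCoordRepWeightsProofs
import Literature.Computability.AlgebraicComplexity.PlethysmStability
import Literature.Computability.AlgebraicComplexity.BorderApolarityMembership
import Summits.ValiantsHypothesis.ValiantsHypothesis.Theorems.ValuativeGCTValuativeFlipSemigroupFloor

/-!
# Per-side certificates for `ValuativeFlip`: the certificate bridge, the weight-multiplicity
# ceiling of plethysm tables, and the tableau / mod-`p` certificate formats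
(crux `ValuativeGCT.ValuativeFlip`, stmt-ValiantsHypothesis-12624; wall-breaker axis k10 / P-tables
"plethysm tables for seedRichness (small cases certified)", 2026-08-16)

Companions landed the same hour on the same axis: `…SeedCeiling.lean` (k2: `#seeds ≤ mult ≤ plethysm`,
Kadish–Landsberg pinning), `…SeedTableConstraints.lean` (k6: the RAY ceiling
`C(k + D, D) ≤ plethysmCoeff (k • χ)`, thresholds) and `…EvalRankLowerBoundK3.lean` (k3: siege stub
`stub_evalRankLowerBound`).  This file adds the pieces a COMPUTED table row needs to enter the tree
as a per-side LOWER bound, and the enumerable upper side of a table entry: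

* §1 **Certificate bridge** (general form of the siege stub): highest-weight vectors `F_i` of
  weight `χ` of `ℂ[Sym^m ℂ^σ]` and points `p_j` of the zero locus of `I(GL · f)` (orbit points
  `g · f`, End-points `A · f` with `A` singular allowed, degenerations) whose evaluation matrix
  `(F_i(p_j))` has linearly independent rows give `r ≤ orbitMultiplicity ℂ f m χ`, `m ≠ 0`
  (`le_orbitMultiplicity_of_certificate` — registered stub —, `…_of_orbit_certificate`,
  `…_of_det_ne_zero`, `…_of_linSubst_certificate`, `…_of_closure_certificate` (degenerations
  `q ∈ orbitClosure f`, via `mem_orbitClosure_iff_formCoeff_holds`), `…_paddedPer_…`).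
* §2 **Table entries ≤ weight multiplicities.** `plethysmCoeff ℂ σ m χ ≤ #S` for any finite `S`
  containing all exponent patterns of torus weight `χ` (`plethysmCoeff_le_card_of_forall_mem`),
  canonically `≤ #{s | monWeight s = χ}`, a finite set for `m ≠ 0`
  (`plethysmCoeff_le_ncard_monWeight`); with the ray ceiling, the enumerable seed test
  `C(k + D, D) ≤ #{s | monWeight s = k • χ}` (`seed_binomial_le_ncard_monWeight`).
* §3 **Tableau certificates.** `(formOfWord ρ n d x)(a) = ∑_E x(word of E) ∏_r a(E r)`
  (`aeval_formOfWord`), hence `le_orbitMultiplicity_of_word_certificate` for wreath-invariant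
  word-model highest-weight vectors (BIP's tableau vectors `tabVector`): the complete format of a
  certified entry `mult_{λ*} ℂ[Δ_m(X₀₀^{m-n} per_n)] ≥ r`, up to the exact evaluation of finitely
  many values `x(word)`.
* §4 **Mod-`p` certificates.** An INTEGER evaluation matrix with `det ≢ 0 (mod p)` suffices
  (`le_orbitMultiplicity_of_int_certificate_zmod`, `…_linSubst`) — "a nonzero residue mod p"
  of `Cruxes/ValuativeFlip/DECOMPOSITIONS.md` (PE1) made formal.

Sources: Mulmuley–Sohoni 2001 §4–5; BLMW, SIAM J. Comput. 40 (2011) §4.4, §5.2; BIP, J. AMS 32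
(2019) §4 (4.1), Thm. 4.7; Bürgisser–Ikenmeyer STOC 2013 §2 (evaluating highest-weight vectors at
points of the orbit closure); Fulton–Harris §15.5; this crux's DECOMPOSITIONS.md; folklore.
-/

set_option linter.dupNamespace false

namespace Summit.ValiantsHypothesis.ValiantsHypothesis.Theorems.ValuativeFlip

open scoped BigOperators Matrix
open Literature.NumberTheory.DiophantineGeometry Literature.Computability.AlgebraicComplexity
open MvPolynomial

noncomputable section

/-! ## §1 The certificate bridge: evaluation matrices give multiplicity lower bounds -/

/-- Linear independence modulo `I(GL · f)` from an evaluation matrix: if the `p_j` are points of the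
zero locus of `I(GL · f)` and the rows `(F_i(p_j))_j` are linearly independent, then the classes of the
`F_i` in `ℂ[Δ_m(f)] = ℂ[Sym^m] ⧸ I(GL · f)` are linearly independent. [folklore] -/
theorem linearIndependent_mk_of_eval {σ : Type*} [Fintype σ] [LinearOrder σ] {m : ℕ}
    (f : MvPolynomial σ ℂ) {ι κ : Type*} [Fintype ι]
    (F : ι → MvPolynomial (DegIdx σ m) ℂ) (p : κ → (DegIdx σ m → ℂ))
    (hp : ∀ j, ∀ G ∈ orbitVanishingIdeal f m, aeval (p j) G = 0)
    (hM : LinearIndependent ℂ (fun i : ι => fun j : κ => aeval (p j) (F i))) :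
    LinearIndependent ℂ (fun i => Ideal.Quotient.mkₐ ℂ (orbitVanishingIdeal f m) (F i)) := by
  classical
  rw [Fintype.linearIndependent_iff] at hM ⊢
  intro c hc i
  refine hM c ?_ i
  have hmem : ∑ i, c i • F i ∈ orbitVanishingIdeal f m := by
    rw [← Ideal.Quotient.eq_zero_iff_mem, ← Ideal.Quotient.mkₐ_eq_mk ℂ, map_sum]
    simpa only [map_smul] using hc
  funext j
  have h0 := hp j _ hmem
  rw [map_sum] at h0
  simp only [map_smul, smul_eq_mul] at h0
  simpa only [Finset.sum_apply, Pi.smul_apply, smul_eq_mul, Pi.zero_apply] using h0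

/-- **Certificate bridge.** For any polynomial `f`, `m ≠ 0`, highest-weight vectors `F₁ … F_r` of
weight `χ` of `ℂ[Sym^m ℂ^σ]` (`coordRep`) and points `p_j` of the zero locus of `I(GL · f)`: if the
rows of the evaluation matrix `(F_i(p_j))` are linearly independent then `r ≤ orbitMultiplicity ℂ f m χ`
(classes are independent `B`-semi-invariants, `linearIndependent_mk_of_eval`,
`mk_mem_highestWeightSpace_orbitCoordRep`, in a finite-dimensional highest-weight space).
[Bürgisser–Ikenmeyer STOC 2013 §2; BLMW 2011 §4.4; folklore] -/
theorem le_orbitMultiplicity_of_certificate {σ : Type*} [Fintype σ] [LinearOrder σ] {m : ℕ}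
    (hm : m ≠ 0) (f : MvPolynomial σ ℂ) (χ : Weight σ) {r : ℕ} {κ : Type*}
    (F : Fin r → MvPolynomial (DegIdx σ m) ℂ)
    (hF : ∀ i, F i ∈ highestWeightSpace (coordRep σ ℂ m) χ)
    (p : κ → (DegIdx σ m → ℂ)) (hp : ∀ j, ∀ G ∈ orbitVanishingIdeal f m, aeval (p j) G = 0)
    (hM : LinearIndependent ℂ (fun i : Fin r => fun j : κ => aeval (p j) (F i))) :
    r ≤ orbitMultiplicity ℂ f m χ := by
  haveI := finiteDimensional_highestWeightSpace_orbitCoordRep_holds (k := ℂ) f hm χ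
  have hli := linearIndependent_mk_of_eval f F p hp hM
  set W := highestWeightSpace (orbitCoordRep f m) χ with hW
  let y : Fin r → W := fun i =>
    ⟨Ideal.Quotient.mkₐ ℂ (orbitVanishingIdeal f m) (F i), mk_mem_highestWeightSpace_orbitCoordRep f (hF i)⟩
  have hy : LinearIndependent ℂ y := LinearIndependent.of_comp W.subtype hli
  have h := hy.fintype_card_le_finrank
  rw [Fintype.card_fin] at h
  unfold orbitMultiplicity hwMultiplicity
  exact h

/-- Certificate bridge at ORBIT points: with `p_j` the coefficient vectors of `g_j · f`
(`g_j ∈ GL`), linearly independent rows of `(F_i(g_j · f))` give `r ≤ orbitMultiplicity ℂ f m χ`.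
[Bürgisser–Ikenmeyer STOC 2013 §2; folklore] -/
theorem le_orbitMultiplicity_of_orbit_certificate {σ : Type*} [Fintype σ] [LinearOrder σ] {m : ℕ}
    (hm : m ≠ 0) (f : MvPolynomial σ ℂ) (χ : Weight σ) {r : ℕ} {κ : Type*}
    (F : Fin r → MvPolynomial (DegIdx σ m) ℂ)
    (hF : ∀ i, F i ∈ highestWeightSpace (coordRep σ ℂ m) χ) (g : κ → GL σ ℂ)
    (hM : LinearIndependent ℂ
      (fun i : Fin r => fun j : κ => aeval (formCoeff m (linSubstRep σ ℂ (g j) f)) (F i))) :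
    r ≤ orbitMultiplicity ℂ f m χ :=
  le_orbitMultiplicity_of_certificate hm f χ F hF (fun j => formCoeff m (linSubstRep σ ℂ (g j) f))
    (fun j _ hG => (mem_orbitVanishingIdeal_iff.mp hG) (g j)) hM

/-- Certificate bridge, square form: a nonsingular `r × r` evaluation matrix suffices. [folklore] -/
theorem le_orbitMultiplicity_of_det_ne_zero {σ : Type*} [Fintype σ] [LinearOrder σ] {m : ℕ}
    (hm : m ≠ 0) (f : MvPolynomial σ ℂ) (χ : Weight σ) {r : ℕ}
    (F : Fin r → MvPolynomial (DegIdx σ m) ℂ)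
    (hF : ∀ i, F i ∈ highestWeightSpace (coordRep σ ℂ m) χ)
    (p : Fin r → (DegIdx σ m → ℂ)) (hp : ∀ j, ∀ G ∈ orbitVanishingIdeal f m, aeval (p j) G = 0)
    (hdet : (Matrix.of fun i j : Fin r => aeval (p j) (F i)).det ≠ 0) :
    r ≤ orbitMultiplicity ℂ f m χ := by
  refine le_orbitMultiplicity_of_certificate hm f χ F hF p hp ?_
  have h := Matrix.linearIndependent_rows_of_det_ne_zero hdet
  exact h

/-- The certificate bridge for the padded permanent: an evaluation matrix of highest-weight vectors
of weight `χ` at points of `Δ_m(X₀₀^{m-n} per_n)` (zero locus of the vanishing ideal) with linearly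
independent rows certifies `r ≤ mult_χ ℂ[Δ_m(X₀₀^{m-n} per_n)]`, the per-side quantity of
`ValuativeFlip`. [Bürgisser–Ikenmeyer STOC 2013 §2; folklore] -/
theorem le_orbitMultiplicity_paddedPer_of_certificate {n m : ℕ} [NeZero m]
    (χ : Weight (MatIdx m)) {r : ℕ} {κ : Type*}
    (F : Fin r → MvPolynomial (DegIdx (MatIdx m) m) ℂ)
    (hF : ∀ i, F i ∈ highestWeightSpace (coordRep (MatIdx m) ℂ m) χ)
    (p : κ → (DegIdx (MatIdx m) m → ℂ))
    (hp : ∀ j, ∀ G ∈ orbitVanishingIdeal (paddedPerFormLex ℂ n m) m, aeval (p j) G = 0)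
    (hM : LinearIndependent ℂ (fun i : Fin r => fun j : κ => aeval (p j) (F i))) :
    r ≤ orbitMultiplicity ℂ (paddedPerFormLex ℂ n m) m χ :=
  le_orbitMultiplicity_of_certificate (NeZero.ne m) _ χ F hF p hp hM

/-- Points `A · f` with `A ∈ End(ℂ^σ)` ANY matrix (singular allowed) lie in the zero locus of
`I(GL · f)`: the ideal is the kernel of the generic orbit map `F ↦ (A ↦ F(A · f))`
(`orbitVanishingIdeal_eq_ker_genericOrbitMap`), whose value at `A` is `F(A · f)`
(`eval_genericOrbitMap`). [Mulmuley–Sohoni 2001 §4; folklore] -/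
theorem aeval_formCoeff_linSubst_eq_zero_of_mem {σ : Type*} [Fintype σ] [LinearOrder σ] {m : ℕ}
    (f : MvPolynomial σ ℂ) (A : Matrix σ σ ℂ) {G : MvPolynomial (DegIdx σ m) ℂ}
    (hG : G ∈ orbitVanishingIdeal f m) : aeval (formCoeff m (linSubst σ ℂ A f)) G = 0 := by
  rw [orbitVanishingIdeal_eq_ker_genericOrbitMap, RingHom.mem_ker] at hG
  have h := eval_genericOrbitMap f m G A
  unfold genericOrbitMap at h
  rw [← h, hG, map_zero]

/-- Certificate bridge at END-points `A_j · f` (ANY matrices, singular allowed; rectangular form with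
independent rows) — the general form of the landed siege stub `stub_evalRankLowerBound`
(`Theorems/ValuativeGCTValuativeFlipEvalRankLowerBoundK3.lean`, square nonsingular case).
[Mulmuley–Sohoni 2001 §4–5; folklore] -/
theorem le_orbitMultiplicity_of_linSubst_certificate {σ : Type*} [Fintype σ] [LinearOrder σ] {m : ℕ}
    (hm : m ≠ 0) (f : MvPolynomial σ ℂ) (χ : Weight σ) {r : ℕ} {κ : Type*}
    (F : Fin r → MvPolynomial (DegIdx σ m) ℂ)
    (hF : ∀ i, F i ∈ highestWeightSpace (coordRep σ ℂ m) χ) (A : κ → Matrix σ σ ℂ)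
    (hM : LinearIndependent ℂ
      (fun i : Fin r => fun j : κ => aeval (formCoeff m (linSubst σ ℂ (A j) f)) (F i))) :
    r ≤ orbitMultiplicity ℂ f m χ :=
  le_orbitMultiplicity_of_certificate hm f χ F hF (fun j => formCoeff m (linSubst σ ℂ (A j) f))
    (fun j _ hG => aeval_formCoeff_linSubst_eq_zero_of_mem f (A j) hG) hM

/-- Points of the orbit CLOSURE lie in the zero locus: for a nonzero form `f` of degree `m` and a
degeneration `q ∈ orbitClosure f`, every element of `I(GL · f)` vanishes at `formCoeff m q`
(`mem_orbitClosure_iff_formCoeff_holds`). [Mulmuley–Sohoni 2001 §4; folklore] -/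
theorem aeval_formCoeff_eq_zero_of_mem_orbitClosure {σ : Type*} [Fintype σ] [LinearOrder σ] {m : ℕ}
    {f q : MvPolynomial σ ℂ} (hf : f.IsHomogeneous m) (hf0 : f ≠ 0) (hq : q ∈ orbitClosure f)
    {G : MvPolynomial (DegIdx σ m) ℂ} (hG : G ∈ orbitVanishingIdeal f m) :
    aeval (formCoeff m q) G = 0 := by
  have h := ((mem_orbitClosure_iff_formCoeff_holds hf hf0).mp hq).2
  rw [MvPolynomial.mem_zeroLocus_iff] at h
  exact h G hG

/-- Certificate bridge at DEGENERATIONS: highest-weight vectors evaluated at points `q_j` of the orbit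
closure `Δ(f)` (`f` a nonzero form of degree `m ≠ 0`; e.g. monomial or power-sum limits, where
tableau functions are closed counts) with linearly independent rows give `r ≤ orbitMultiplicity ℂ f m χ`.
[Bürgisser–Ikenmeyer STOC 2013 §2; arXiv:1911.03990 §3; folklore] -/
theorem le_orbitMultiplicity_of_closure_certificate {σ : Type*} [Fintype σ] [LinearOrder σ] {m : ℕ}
    (hm : m ≠ 0) {f : MvPolynomial σ ℂ} (hf : f.IsHomogeneous m) (hf0 : f ≠ 0) (χ : Weight σ)
    {r : ℕ} {κ : Type*} (F : Fin r → MvPolynomial (DegIdx σ m) ℂ)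
    (hF : ∀ i, F i ∈ highestWeightSpace (coordRep σ ℂ m) χ)
    (q : κ → MvPolynomial σ ℂ) (hq : ∀ j, q j ∈ orbitClosure f)
    (hM : LinearIndependent ℂ (fun i : Fin r => fun j : κ => aeval (formCoeff m (q j)) (F i))) :
    r ≤ orbitMultiplicity ℂ f m χ :=
  le_orbitMultiplicity_of_certificate hm f χ F hF (fun j => formCoeff m (q j))
    (fun j _ hG => aeval_formCoeff_eq_zero_of_mem_orbitClosure hf hf0 (hq j) hG) hM

/-- The padded permanent `X₀₀^{m-n} per_n` is a nonzero form (`paddedPerPoly_ne_zero` transported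
along `rename toLex`). [folklore] -/
theorem paddedPerFormLex_ne_zero' (n m : ℕ) [NeZero m] : paddedPerFormLex ℂ n m ≠ 0 := by
  intro h
  apply Literature.Computability.AlgebraicComplexity.BorderApolarity.paddedPerPoly_ne_zero n m
  exact MvPolynomial.rename_injective _ toLex.injective (by rw [map_zero]; exact h)

/-- Certificate bridge for the padded permanent at DEGENERATIONS `q_j ∈ Δ_m(X₀₀^{m-n} per_n)`
(`n ≤ m`): linearly independent rows of `(F_i(q_j))` give `r ≤ mult_χ ℂ[Δ_m(X₀₀^{m-n} per_n)]`.
[Bürgisser–Ikenmeyer STOC 2013 §2; folklore] -/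
theorem le_orbitMultiplicity_paddedPer_of_closure_certificate {n m : ℕ} [NeZero m] (hnm : n ≤ m)
    (χ : Weight (MatIdx m)) {r : ℕ} {κ : Type*}
    (F : Fin r → MvPolynomial (DegIdx (MatIdx m) m) ℂ)
    (hF : ∀ i, F i ∈ highestWeightSpace (coordRep (MatIdx m) ℂ m) χ)
    (q : κ → MvPolynomial (MatIdx m) ℂ) (hq : ∀ j, q j ∈ orbitClosure (paddedPerFormLex ℂ n m))
    (hM : LinearIndependent ℂ (fun i : Fin r => fun j : κ => aeval (formCoeff m (q j)) (F i))) :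
    r ≤ orbitMultiplicity ℂ (paddedPerFormLex ℂ n m) m χ :=
  le_orbitMultiplicity_of_closure_certificate (NeZero.ne m)
    (paddedPerFormLex_isHomogeneous (k := ℂ) hnm) (paddedPerFormLex_ne_zero' n m) χ F hF q hq hM

/-! ## §2 Plethysm table entries are bounded by weight multiplicities (enumerable counts) -/

/-- Torus weight vectors of `ℂ[Sym^m ℂ^σ]` of weight `χ` are linear combinations of the monomials
`∏_d X_d^{s(d)}` of torus weight `monWeight s = χ` (a weight vector coincides with its weight-`χ`
part, `monWeight_eq_of_mem_weightSpace`). Fulton–Harris §15.5. [folklore] -/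
theorem weightSpace_coordRep_le_span_monomial {σ : Type*} [Fintype σ] [LinearOrder σ] {m : ℕ}
    (χ : Weight σ) :
    weightSpace (coordRep σ ℂ m) χ ≤
      Submodule.span ℂ ((fun s => monomial s (1 : ℂ)) '' {s : DegIdx σ m →₀ ℕ | monWeight s = χ}) := by
  classical
  intro F hF
  rw [MvPolynomial.as_sum F]
  refine Submodule.sum_mem _ fun s hs => ?_
  have h1 : monomial s (coeff s F) = coeff s F • monomial s (1 : ℂ) := by
    rw [smul_monomial, smul_eq_mul, mul_one]
  rw [h1]
  exact Submodule.smul_mem _ _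
    (Submodule.subset_span ⟨s, monWeight_eq_of_mem_weightSpace hF hs, rfl⟩)

/-- A weight pins the degree: `monWeight s = χ` forces `s.degree = (-|χ|)/m` (`m ≠ 0`). [BLMW 2011 §4.4] -/
theorem degree_eq_of_monWeight_eq {σ : Type*} [Fintype σ] [LinearOrder σ] {m : ℕ} (hm : m ≠ 0)
    {χ : Weight σ} {s : DegIdx σ m →₀ ℕ} (hs : monWeight s = χ) :
    s.degree = (-χ.size).toNat / m := by
  classical
  have hsize := size_monWeight s
  rw [hs] at hsize
  have h1 : (-χ.size).toNat = m * s.degree := by rw [hsize, neg_neg, Int.toNat_natCast]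
  rw [h1, Nat.mul_div_cancel_left _ (Nat.pos_of_ne_zero hm)]

/-- **Plethysm table entries are at most weight multiplicities.** If a finite set `S` of exponent
patterns contains every pattern `s` of torus weight `monWeight s = χ` then
`plethysmCoeff ℂ σ m χ ≤ #S` (highest-weight vectors are weight vectors; the weight space of weight `χ`
is spanned by the monomials of that weight). [Fulton–Harris §15.5; BLMW 2011 §4.4; folklore] -/
theorem plethysmCoeff_le_card_of_forall_mem {σ : Type*} [Fintype σ] [LinearOrder σ] {m : ℕ}
    (χ : Weight σ) (S : Finset (DegIdx σ m →₀ ℕ)) (hS : ∀ s, monWeight s = χ → s ∈ S) :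
    plethysmCoeff ℂ σ m χ ≤ S.card := by
  set b : ↥S → MvPolynomial (DegIdx σ m) ℂ := fun s => monomial (s : DegIdx σ m →₀ ℕ) (1 : ℂ)
    with hb
  have hle : highestWeightSpace (coordRep σ ℂ m) χ ≤ Submodule.span ℂ (Set.range b) := by
    refine (highestWeightSpace_le_weightSpace _ _).trans
      ((weightSpace_coordRep_le_span_monomial χ).trans (Submodule.span_mono ?_))
    rintro _ ⟨s, hs, rfl⟩
    exact ⟨⟨s, hS s hs⟩, rfl⟩
  haveI : Module.Finite ℂ ↥(Submodule.span ℂ (Set.range b)) :=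
    Module.Finite.span_of_finite ℂ (Set.finite_range b)
  have h1 : Module.finrank ℂ ↥(highestWeightSpace (coordRep σ ℂ m) χ) ≤
      Module.finrank ℂ ↥(Submodule.span ℂ (Set.range b)) := Submodule.finrank_mono hle
  have h2 : Module.finrank ℂ ↥(Submodule.span ℂ (Set.range b)) ≤ Fintype.card ↥S := by
    have h := finrank_range_le_card (R := ℂ) b
    unfold Set.finrank at h
    exact h
  rw [Fintype.card_coe] at h2
  have h4 : plethysmCoeff ℂ σ m χ = Module.finrank ℂ ↥(highestWeightSpace (coordRep σ ℂ m) χ) := rfl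
  rw [h4]
  exact h1.trans h2

/-- For `m ≠ 0` the exponent patterns of a given torus weight `χ` form a FINITE set (they all have
total degree `(-|χ|)/m`, `degree_eq_of_monWeight_eq`, i.e. lie in `degMonomials _ ((-|χ|)/m)`).
[BLMW 2011 §4.4; folklore] -/
theorem finite_setOf_monWeight_eq {σ : Type*} [Fintype σ] [LinearOrder σ] {m : ℕ} (hm : m ≠ 0)
    (χ : Weight σ) : {s : DegIdx σ m →₀ ℕ | monWeight s = χ}.Finite := by
  refine (degMonomials (DegIdx σ m) ((-χ.size).toNat / m)).finite_toSet.subset ?_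
  intro s hs
  rw [Finset.mem_coe, mem_degMonomials_iff]
  exact degree_eq_of_monWeight_eq hm hs

/-- **Plethysm table entries are at most weight multiplicities** (canonical form, `m ≠ 0`):
`plethysmCoeff ℂ σ m χ ≤ #{exponent patterns of torus weight χ}` (`Set.ncard` of a finite set,
`finite_setOf_monWeight_eq`). [Fulton–Harris §15.5; BLMW 2011 §4.4; folklore] -/
theorem plethysmCoeff_le_ncard_monWeight {σ : Type*} [Fintype σ] [LinearOrder σ] {m : ℕ}
    (hm : m ≠ 0) (χ : Weight σ) :
    plethysmCoeff ℂ σ m χ ≤ {s : DegIdx σ m →₀ ℕ | monWeight s = χ}.ncard := by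
  have hfin := finite_setOf_monWeight_eq hm χ
  rw [Set.ncard_eq_toFinset_card _ hfin]
  exact plethysmCoeff_le_card_of_forall_mem χ hfin.toFinset
    (fun s hs => (Set.Finite.mem_toFinset hfin).mpr hs)

/-- **The seed ray ceiling in enumerable form**: `D + 1` algebraically independent highest-weight
vectors of weight `χ` in `ℂ[Δ_m(f)]` (`f` a form of degree `m ≠ 0`) force
`C(k + D, D) ≤ #{exponent patterns of torus weight k • χ}` for every `k` (semigroup floor
`semigroupFloor`, p98674, ∘ BLMW bound = the ray ceiling of `…SeedTableConstraints.lean`, ∘ §2). [this crux] -/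
theorem seed_binomial_le_ncard_monWeight {σ : Type} [Fintype σ] [LinearOrder σ]
    (f : MvPolynomial σ ℂ) {m : ℕ} (hm : m ≠ 0) (hf : f.IsHomogeneous m) (χ : Weight σ) (D : ℕ)
    (F : Fin (D + 1) → OrbitCoordRing f m)
    (hF : ∀ i, F i ∈ highestWeightSpace (orbitCoordRep f m) χ) (hind : AlgebraicIndependent ℂ F)
    (k : ℕ) :
    (k + D).choose D ≤ {s : DegIdx σ m →₀ ℕ | monWeight s = k • χ}.ncard :=
  ((semigroupFloor f hm χ D F hF hind k).trans
    (orbitMultiplicity_le_plethysmCoeff_holds f hm hf (k • χ))).trans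
      (plethysmCoeff_le_ncard_monWeight hm (k • χ))

/-! ## §3 Tableau certificates: evaluating word-model highest-weight vectors at a form -/

/-- **Evaluation of `formOfWord` at a coefficient vector** (the matrix entry of a tableau
certificate, a closed finite sum): `(formOfWord ρ n d x)(a) = ∑_E x(word of contents E) · ∏_r a(E r)`
over `d`-tuples `E` of degree-`n` monomial types; at a `0/1`-coefficient form (a permuted padded
permanent) only tuples of its monomials contribute. [BIP 2019 §4 (4.1), Thm. 4.7; folklore] -/
theorem aeval_formOfWord {σ : Type*} [LinearOrder σ] [Fintype σ] {M n d : ℕ} (ρ : Fin M ≃ σ)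
    (x : Word M (d * n) → ℂ) (a : DegIdx σ n → ℂ) :
    aeval a (formOfWord ρ n d x) =
      ∑ E : Fin d → DegIdx σ n, x (flatOfContents ρ E) * ∏ r, a (E r) := by
  unfold formOfWord
  simp only [map_sum, map_mul, aeval_C, map_prod, aeval_X, Algebra.algebraMap_self, RingHom.id_apply]

/-- **Tableau certificate ⇒ per-side multiplicity lower bound.** For `ρ : Fin M ≃ σ` order
reversing, wreath-invariant (`S_δ ≀ S_m`) highest-weight vectors `x_i` of the word model of weight
`l ↦ -χ(ρ l)` (e.g. BIP's `tabVector` of shape `λ`, `χ = λ*`) and points `p_j` of the zero locus of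
`I(GL · f)` (`m ≠ 0`): linearly independent rows of the matrix of closed sums
`(∑_E x_i(word of E) ∏_t p_j(E t))` give `r ≤ orbitMultiplicity ℂ f m χ`; what a certified table
row still needs is the exact evaluation of the finitely many values `x_i(word of E)`.
[BIP 2019 §4; Bürgisser–Ikenmeyer STOC 2013 §2; this file] -/
theorem le_orbitMultiplicity_of_word_certificate {σ : Type*} [LinearOrder σ] [Fintype σ]
    {M m δ : ℕ} (hm : m ≠ 0) {ρ : Fin M ≃ σ} (hρ : StrictAnti ρ) (f : MvPolynomial σ ℂ)
    (χ : Weight σ) {r : ℕ} {κ : Type*} (x : Fin r → (Word M (δ * m) → ℂ))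
    (hx : ∀ i, ∀ τ ∈ blockPerms δ m, wordPerm ℂ τ (x i) = x i)
    (hxw : ∀ i, x i ∈ highestWeightSpace (wordRep ℂ M (δ * m)) (fun l => -χ (ρ l)))
    (p : κ → (DegIdx σ m → ℂ)) (hp : ∀ j, ∀ G ∈ orbitVanishingIdeal f m, aeval (p j) G = 0)
    (hM : LinearIndependent ℂ (fun i : Fin r => fun j : κ =>
      ∑ E : Fin δ → DegIdx σ m, x i (flatOfContents ρ E) * ∏ t, p j (E t))) :
    r ≤ orbitMultiplicity ℂ f m χ := by
  refine le_orbitMultiplicity_of_certificate hm f χ (fun i => formOfWord ρ m δ (x i))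
    (fun i => formOfWord_mem_highestWeightSpace hρ (hx i) (hxw i)) p hp ?_
  have hfun : (fun i : Fin r => fun j : κ => aeval (p j) (formOfWord ρ m δ (x i))) =
      (fun i : Fin r => fun j : κ => ∑ E : Fin δ → DegIdx σ m, x i (flatOfContents ρ E) * ∏ t, p j (E t)) := by
    funext i j
    exact aeval_formOfWord ρ (x i) (p j)
  rw [hfun]
  exact hM

/-! ## §4 Certificates by a nonzero residue mod `p` -/

/-- An integer matrix with `det ≢ 0 (mod p)` has nonzero determinant over `ℂ`. [folklore] -/
theorem det_map_complex_ne_zero_of_zmod {r p : ℕ} (M : Matrix (Fin r) (Fin r) ℤ)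
    (h : (M.map (Int.castRingHom (ZMod p))).det ≠ 0) :
    (M.map (Int.castRingHom ℂ)).det ≠ 0 := by
  have key : ∀ {S : Type} [CommRing S] (g : ℤ →+* S), (M.map g).det = g M.det := by
    intro S _ g
    rw [RingHom.map_det, RingHom.mapMatrix_apply]
  have hZ : M.det ≠ 0 := by
    intro h0
    apply h
    rw [key, h0, map_zero]
  rw [key, eq_intCast]
  exact_mod_cast hZ

/-- **Integer certificate checked mod `p` ⇒ per-side multiplicity lower bound** (the format
"a nonzero residue mod p suffices" of `Cruxes/ValuativeFlip/DECOMPOSITIONS.md`, PE1): highest-weight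
vectors `F_i` of weight `χ` of `ℂ[Sym^m ℂ^σ]`, points `p_j` of the zero locus of `I(GL · f)`, an
INTEGER matrix `M` with `F_i(p_j) = M i j` and `det M ≢ 0 (mod p)` give `r ≤ orbitMultiplicity ℂ f m χ`
(`m ≠ 0`). [folklore; this file §2] -/
theorem le_orbitMultiplicity_of_int_certificate_zmod {σ : Type*} [Fintype σ] [LinearOrder σ]
    {m : ℕ} (hm : m ≠ 0) (f : MvPolynomial σ ℂ) (χ : Weight σ) {r : ℕ}
    (F : Fin r → MvPolynomial (DegIdx σ m) ℂ)
    (hF : ∀ i, F i ∈ highestWeightSpace (coordRep σ ℂ m) χ)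
    (pt : Fin r → (DegIdx σ m → ℂ)) (hpt : ∀ j, ∀ G ∈ orbitVanishingIdeal f m, aeval (pt j) G = 0)
    (M : Matrix (Fin r) (Fin r) ℤ) (hM : ∀ i j, aeval (pt j) (F i) = (M i j : ℂ))
    {p : ℕ} (hdet : (M.map (Int.castRingHom (ZMod p))).det ≠ 0) :
    r ≤ orbitMultiplicity ℂ f m χ := by
  refine le_orbitMultiplicity_of_det_ne_zero hm f χ F hF pt hpt ?_
  have hmat : (Matrix.of fun i j : Fin r => aeval (pt j) (F i)) = M.map (Int.castRingHom ℂ) := by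
    ext i j
    simp only [Matrix.of_apply, Matrix.map_apply, eq_intCast, hM i j]
  rw [hmat]
  exact det_map_complex_ne_zero_of_zmod M hdet

/-- The same at End-points `A_j · f` (ANY matrices, singular allowed). [folklore; this file §2] -/
theorem le_orbitMultiplicity_of_int_certificate_zmod_linSubst {σ : Type*} [Fintype σ] [LinearOrder σ]
    {m : ℕ} (hm : m ≠ 0) (f : MvPolynomial σ ℂ) (χ : Weight σ) {r : ℕ}
    (F : Fin r → MvPolynomial (DegIdx σ m) ℂ)
    (hF : ∀ i, F i ∈ highestWeightSpace (coordRep σ ℂ m) χ)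
    (A : Fin r → Matrix σ σ ℂ) (M : Matrix (Fin r) (Fin r) ℤ)
    (hM : ∀ i j, aeval (formCoeff m (linSubst σ ℂ (A j) f)) (F i) = (M i j : ℂ))
    {p : ℕ} (hdet : (M.map (Int.castRingHom (ZMod p))).det ≠ 0) :
    r ≤ orbitMultiplicity ℂ f m χ :=
  le_orbitMultiplicity_of_int_certificate_zmod hm f χ F hF (fun j => formCoeff m (linSubst σ ℂ (A j) f))
    (fun j _ hG => aeval_formCoeff_linSubst_eq_zero_of_mem f (A j) hG) M hM hdet

end

end Summit.ValiantsHypothesis.ValiantsHypothesis.Theorems.ValuativeFlip
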